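import Summits.ValiantsHypothesis.ValiantsHypothesis.Theorems.KPlusLogSqLawStaticTridiagonalPivotLogConcave

/-!
# The ALTERNATING pivot pattern of a continuant along geometric interpolations:
# odd pivots log-CONVEX, even pivots log-CONCAVE (Part 3a of the inertia-class laws for static definite tridiagonal designs)

HONEST FRAMING.  Helper theorems (`--supports stmt-ValiantsHypothesis-19561 --as helper`; seat val-sym-lift-p2 g9, cell
`pub-symmetroid`, 2026-08-27) — the ABSTRACT half of the TOP-CLASS LAW on the REAL side of the desk's typed α target (lead R2102/R2114,
static definite tridiagonal monomial matrices).  Pure real analysis of the tree's continuant `ValuativeFlip.ctK`, continuing Part 1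
(`…StaticTridiagonalPivotLogConcave`: two-term Hölder, log-concavity of the pivots on the positive-definite pattern).  Nothing here
bounds the number of zeros of anything, and nothing bears on `WeakLifting` (stmt-19561) / `TropicalB` (stmt-19771) in their windows,
Conjecture B, the Door-A registers, `MatrixDescartes` (stmt-ValiantsHypothesis-18050) or VP ≠ VNP.  Part 3b (`…StaticTridiagonalTopClass`)
specialises to the design and states the MAXIMALLY-INDEFINITE-INTERVAL THEOREM and the TOP-CLASS LAW «Z_(n−1) ≤ 2 (even m = 2n)».

WHAT IS PROVED.  Continuant `K₀ = 1, K₁ = L 0, K_{k+2} = L (k+1) K_{k+1} + M k · N (k+1) · K_k` with `L > 0`, link weights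
`w_k := −(M k · N (k+1)) ≥ 0`, three data sets of which the third is the `(p, q)` geometric interpolation of the first two
(`L = L₁^p L₂^q`, `w = w₁^p w₂^q`, `p, q > 0`, `p + q = 1`); pivots `π_{k+1} := K_{k+1}/K_k`.  The ALTERNATING pattern is
`0 < (−1)^k π_{k+1}` (`π₁ > 0, π₂ < 0, π₃ > 0, …`; by Jacobi's signature rule: the leading blocks have the maximal number of negative
eigenvalues).  On it the recursion reads `π_{2i+1} = L_{2i} + w_{2i−1}/|π_{2i}|` and `|π_{2i+2}| = w_{2i}/π_{2i+1} − L_{2i+1}`, whence: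
1. `alt_even_step`, `alt_odd_step` — the two real-number steps (difference form of Hölder, resp. Hölder itself);
2. **`ctK_alt_interp`** — if the pivots alternate for `k ≤ 2i` at both endpoints then they alternate at the interpolation, the odd
   pivots being log-CONVEX (`π_{2i+1} ≤ π₁_{2i+1}^p π₂_{2i+1}^q`) and (inside the induction) the even ones log-CONCAVE in absolute value;
3. `ctK_alt_semidef_interp` (next even pivot `≤ 0` at both endpoints ⇒ `≤ 0` in between), `ctK_alt_interp_succ` (odd prefixes),
   `ctK_alt_pattern_interp` (any prefix `k < K`), `ne_zero_of_sign_div` (bookkeeping).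
[folklore: Hölder's inequality; continuants / LDLᵀ; the convexity pattern is this seat's.]
-/

set_option linter.dupNamespace false
set_option autoImplicit false

namespace Summit.ValiantsHypothesis.ValiantsHypothesis.Theorems.KPlusLogSqLaw.DefiniteInterpolation

open Summit.ValiantsHypothesis.ValiantsHypothesis.Theorems.ValuativeFlip (ctK ctK_zero ctK_one ctK_add_two)

/-! ### Two real-number steps -/

/-- **Even step** (log-concavity of the magnitude of a negative pivot): with `r ≤ r₁^p r₂^q` (`r, rᵢ > 0`), `L = L₁^p L₂^q`,
`w = w₁^p w₂^q` (`wᵢ ≥ 0`) and `Lᵢ ≤ wᵢ / rᵢ`, one has `(w₁/r₁ − L₁)^p (w₂/r₂ − L₂)^q ≤ w/r − L`. [this file] -/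
theorem alt_even_step {L₁ L₂ L w₁ w₂ w r₁ r₂ r p q : ℝ} (hp : 0 < p) (hq : 0 < q) (hpq : p + q = 1)
    (hL₁ : 0 ≤ L₁) (hL₂ : 0 ≤ L₂) (hL : L = L₁ ^ p * L₂ ^ q) (hw₁ : 0 ≤ w₁) (hw₂ : 0 ≤ w₂) (hw : w = w₁ ^ p * w₂ ^ q)
    (hr₁ : 0 < r₁) (hr₂ : 0 < r₂) (hr : 0 < r) (hodd : r ≤ r₁ ^ p * r₂ ^ q)
    (hg₁ : L₁ ≤ w₁ / r₁) (hg₂ : L₂ ≤ w₂ / r₂) :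
    (w₁ / r₁ - L₁) ^ p * (w₂ / r₂ - L₂) ^ q ≤ w / r - L := by
  have step1 := sub_rpow_mul_sub_rpow_le (u := w₁ / r₁) (u' := w₂ / r₂) hL₁ hg₁ hL₂ hg₂ hp hq hpq
  have step2 : (w₁ / r₁) ^ p * (w₂ / r₂) ^ q = (w₁ ^ p * w₂ ^ q) / (r₁ ^ p * r₂ ^ q) := by
    rw [Real.div_rpow hw₁ hr₁.le, Real.div_rpow hw₂ hr₂.le, div_mul_div_comm]
  have step3 : (w₁ ^ p * w₂ ^ q) / (r₁ ^ p * r₂ ^ q) ≤ (w₁ ^ p * w₂ ^ q) / r :=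
    div_le_div_of_nonneg_left (mul_nonneg (Real.rpow_nonneg hw₁ p) (Real.rpow_nonneg hw₂ q)) hr hodd
  rw [step2] at step1
  rw [hw, hL]
  linarith

/-- **Odd step** (log-convexity of a positive pivot following a negative one): with `g₁^p g₂^q ≤ g` (`gᵢ > 0`),
`L = L₁^p L₂^q` (`Lᵢ ≥ 0`), `v = v₁^p v₂^q` (`vᵢ ≥ 0`), one has `L + v/g ≤ (L₁ + v₁/g₁)^p (L₂ + v₂/g₂)^q`. [this file] -/
theorem alt_odd_step {L₁ L₂ L v₁ v₂ v g₁ g₂ g p q : ℝ} (hp : 0 < p) (hq : 0 < q) (hpq : p + q = 1)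
    (hL₁ : 0 ≤ L₁) (hL₂ : 0 ≤ L₂) (hL : L = L₁ ^ p * L₂ ^ q) (hv₁ : 0 ≤ v₁) (hv₂ : 0 ≤ v₂) (hv : v = v₁ ^ p * v₂ ^ q)
    (hg₁ : 0 < g₁) (hg₂ : 0 < g₂) (hev : g₁ ^ p * g₂ ^ q ≤ g) :
    L + v / g ≤ (L₁ + v₁ / g₁) ^ p * (L₂ + v₂ / g₂) ^ q := by
  have hglow : 0 < g₁ ^ p * g₂ ^ q := mul_pos (Real.rpow_pos_of_pos hg₁ p) (Real.rpow_pos_of_pos hg₂ q)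
  have t1 : v / g ≤ v / (g₁ ^ p * g₂ ^ q) := by
    rw [hv]
    exact div_le_div_of_nonneg_left (mul_nonneg (Real.rpow_nonneg hv₁ p) (Real.rpow_nonneg hv₂ q)) hglow hev
  have t2 : v / (g₁ ^ p * g₂ ^ q) = (v₁ / g₁) ^ p * (v₂ / g₂) ^ q := by
    rw [hv, Real.div_rpow hv₁ hg₁.le, Real.div_rpow hv₂ hg₂.le, div_mul_div_comm]
  have t3 := holder_two hL₁ (div_nonneg hv₁ hg₁.le) hL₂ (div_nonneg hv₂ hg₂.le) hp hq hpq
  rw [t2] at t1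
  rw [hL]
  linarith

/-! ### The alternating pattern along a geometric interpolation

The pattern is recorded through the PIVOTS: `0 < (−1)^k · K_{k+1}/K_k` for `k < N` (odd-indexed pivots positive, even-indexed
negative; a vanishing `K` is excluded since `x / 0 = 0`). -/

section Alternating

variable {L₁ M₁ N₁ L₂ M₂ N₂ L M N : ℕ → ℝ} {p q : ℝ}

/-- A ratio with a definite sign has non-zero numerator and denominator. [folklore] -/
theorem ne_zero_of_sign_div {a b e : ℝ} (h : 0 < e * (a / b)) : a ≠ 0 ∧ b ≠ 0 := by
  constructor
  · rintro rfl; simp at h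
  · rintro rfl; simp at h

/-- **Alternating interpolation (the induction over pairs of levels).**  If at both endpoints the pivots alternate,
`0 < (−1)^k K_{k+1}/K_k` for `k ≤ 2i`, then the interpolated pivots alternate as well, and the last (odd-indexed, positive) pivot
is log-CONVEX: `K_{2i+1}/K_{2i} ≤ (K₁_{2i+1}/K₁_{2i})^p (K₂_{2i+1}/K₂_{2i})^q`. [this file] -/
theorem ctK_alt_interp (hp : 0 < p) (hq : 0 < q) (hpq : p + q = 1)
    (hL₁ : ∀ k, 0 < L₁ k) (hL₂ : ∀ k, 0 < L₂ k) (hL : ∀ k, L k = L₁ k ^ p * L₂ k ^ q)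
    (hw₁ : ∀ k, 0 ≤ -(M₁ k * N₁ (k + 1))) (hw₂ : ∀ k, 0 ≤ -(M₂ k * N₂ (k + 1)))
    (hw : ∀ k, -(M k * N (k + 1)) = (-(M₁ k * N₁ (k + 1))) ^ p * (-(M₂ k * N₂ (k + 1))) ^ q) :
    ∀ i : ℕ, (∀ k ≤ 2 * i, 0 < (-1 : ℝ) ^ k * (ctK L₁ M₁ N₁ (k + 1) / ctK L₁ M₁ N₁ k)) →
      (∀ k ≤ 2 * i, 0 < (-1 : ℝ) ^ k * (ctK L₂ M₂ N₂ (k + 1) / ctK L₂ M₂ N₂ k)) →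
      (∀ k ≤ 2 * i, 0 < (-1 : ℝ) ^ k * (ctK L M N (k + 1) / ctK L M N k)) ∧
        ctK L M N (2 * i + 1) / ctK L M N (2 * i) ≤
          (ctK L₁ M₁ N₁ (2 * i + 1) / ctK L₁ M₁ N₁ (2 * i)) ^ p *
            (ctK L₂ M₂ N₂ (2 * i + 1) / ctK L₂ M₂ N₂ (2 * i)) ^ q := by
  intro i
  induction i with
  | zero =>
    intro _ _
    have h1 : ctK L M N 1 / ctK L M N 0 = L₁ 0 ^ p * L₂ 0 ^ q := by rw [ctK_one, ctK_zero, div_one, hL 0]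
    refine ⟨fun k hk => ?_, ?_⟩
    · have hk0 : k = 0 := by omega
      subst hk0
      rw [pow_zero, one_mul, h1]
      exact mul_pos (Real.rpow_pos_of_pos (hL₁ 0) p) (Real.rpow_pos_of_pos (hL₂ 0) q)
    · rw [Nat.mul_zero, h1, ctK_one, ctK_zero, ctK_one, ctK_zero, div_one, div_one]
  | succ i ih =>
    intro hK₁ hK₂
    obtain ⟨hK, hodd⟩ := ih (fun k hk => hK₁ k (by omega)) (fun k hk => hK₂ k (by omega))
    -- the pivots in play: r = K(2i+1)/K(2i) > 0, s = K(2i+2)/K(2i+1) < 0, t = K(2i+3)/K(2i+2) > 0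
    have hr₁ : 0 < ctK L₁ M₁ N₁ (2 * i + 1) / ctK L₁ M₁ N₁ (2 * i) := by
      have := hK₁ (2 * i) (by omega); rwa [pow_mul, neg_one_sq, one_pow, one_mul] at this
    have hr₂ : 0 < ctK L₂ M₂ N₂ (2 * i + 1) / ctK L₂ M₂ N₂ (2 * i) := by
      have := hK₂ (2 * i) (by omega); rwa [pow_mul, neg_one_sq, one_pow, one_mul] at this
    have hr : 0 < ctK L M N (2 * i + 1) / ctK L M N (2 * i) := by
      have := hK (2 * i) le_rfl; rwa [pow_mul, neg_one_sq, one_pow, one_mul] at this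
    have hs₁ : ctK L₁ M₁ N₁ (2 * i + 2) / ctK L₁ M₁ N₁ (2 * i + 1) < 0 := by
      have := hK₁ (2 * i + 1) (by omega); rw [pow_succ, pow_mul, neg_one_sq, one_pow, one_mul] at this; linarith
    have hs₂ : ctK L₂ M₂ N₂ (2 * i + 2) / ctK L₂ M₂ N₂ (2 * i + 1) < 0 := by
      have := hK₂ (2 * i + 1) (by omega); rw [pow_succ, pow_mul, neg_one_sq, one_pow, one_mul] at this; linarith
    have hK₁b : ctK L₁ M₁ N₁ (2 * i + 1) ≠ 0 := (ne_zero_of_sign_div (hK₁ (2 * i) (by omega))).1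
    have hK₂b : ctK L₂ M₂ N₂ (2 * i + 1) ≠ 0 := (ne_zero_of_sign_div (hK₂ (2 * i) (by omega))).1
    have hKb : ctK L M N (2 * i + 1) ≠ 0 := (ne_zero_of_sign_div (hK (2 * i) le_rfl)).1
    have hK₁c : ctK L₁ M₁ N₁ (2 * i + 2) ≠ 0 := (ne_zero_of_sign_div (hK₁ (2 * i + 1) (by omega))).1
    have hK₂c : ctK L₂ M₂ N₂ (2 * i + 2) ≠ 0 := (ne_zero_of_sign_div (hK₂ (2 * i + 1) (by omega))).1
    -- pivot recursions at level 2i+2 and 2i+3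
    have e₁ := ctK_pivot_succ L₁ M₁ N₁ (2 * i) hK₁b
    have e₂ := ctK_pivot_succ L₂ M₂ N₂ (2 * i) hK₂b
    have e := ctK_pivot_succ L M N (2 * i) hKb
    set r₁ := ctK L₁ M₁ N₁ (2 * i + 1) / ctK L₁ M₁ N₁ (2 * i) with hr₁def
    set r₂ := ctK L₂ M₂ N₂ (2 * i + 1) / ctK L₂ M₂ N₂ (2 * i) with hr₂def
    set r := ctK L M N (2 * i + 1) / ctK L M N (2 * i) with hrdef
    set w₁ := -(M₁ (2 * i) * N₁ (2 * i + 1)) with hw₁def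
    set w₂ := -(M₂ (2 * i) * N₂ (2 * i + 1)) with hw₂def
    -- even step: the magnitude g = w/r − L(2i+1) of the (negative) even pivot is log-concave
    have hg₁ : L₁ (2 * i + 1) ≤ w₁ / r₁ := by rw [e₁] at hs₁; linarith
    have hg₂ : L₂ (2 * i + 1) ≤ w₂ / r₂ := by rw [e₂] at hs₂; linarith
    have hg₁pos : 0 < w₁ / r₁ - L₁ (2 * i + 1) := by rw [e₁] at hs₁; linarith
    have hg₂pos : 0 < w₂ / r₂ - L₂ (2 * i + 1) := by rw [e₂] at hs₂; linarith
    have hev := alt_even_step hp hq hpq (hL₁ _).le (hL₂ _).le (hL (2 * i + 1)) (hw₁ _) (hw₂ _) (hw (2 * i))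
      hr₁ hr₂ hr hodd hg₁ hg₂
    have hglow : 0 < (w₁ / r₁ - L₁ (2 * i + 1)) ^ p * (w₂ / r₂ - L₂ (2 * i + 1)) ^ q :=
      mul_pos (Real.rpow_pos_of_pos hg₁pos p) (Real.rpow_pos_of_pos hg₂pos q)
    have hgpos : 0 < -(M (2 * i) * N (2 * i + 1)) / r - L (2 * i + 1) := hglow.trans_le hev
    have hs : ctK L M N (2 * i + 2) / ctK L M N (2 * i + 1) < 0 := by rw [e]; linarith
    have hKc : ctK L M N (2 * i + 2) ≠ 0 := by
      intro h0; rw [h0, zero_div] at hs; exact lt_irrefl 0 hs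
    -- odd step: the next pivot t = L(2i+2) + v/g is positive and log-convex
    have f₁ := ctK_pivot_succ L₁ M₁ N₁ (2 * i + 1) hK₁c
    have f₂ := ctK_pivot_succ L₂ M₂ N₂ (2 * i + 1) hK₂c
    have f := ctK_pivot_succ L M N (2 * i + 1) hKc
    -- rewrite the even pivots as −g
    have hs₁eq : ctK L₁ M₁ N₁ (2 * i + 1 + 1) / ctK L₁ M₁ N₁ (2 * i + 1) = -(w₁ / r₁ - L₁ (2 * i + 1)) := by
      rw [show 2 * i + 1 + 1 = 2 * i + 2 from rfl, e₁]; ring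
    have hs₂eq : ctK L₂ M₂ N₂ (2 * i + 1 + 1) / ctK L₂ M₂ N₂ (2 * i + 1) = -(w₂ / r₂ - L₂ (2 * i + 1)) := by
      rw [show 2 * i + 1 + 1 = 2 * i + 2 from rfl, e₂]; ring
    have hseq : ctK L M N (2 * i + 1 + 1) / ctK L M N (2 * i + 1) =
        -(-(M (2 * i) * N (2 * i + 1)) / r - L (2 * i + 1)) := by
      rw [show 2 * i + 1 + 1 = 2 * i + 2 from rfl, e]; ring
    have hodd' : ctK L M N (2 * i + 3) / ctK L M N (2 * i + 2) ≤
        (ctK L₁ M₁ N₁ (2 * i + 3) / ctK L₁ M₁ N₁ (2 * i + 2)) ^ p *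
          (ctK L₂ M₂ N₂ (2 * i + 3) / ctK L₂ M₂ N₂ (2 * i + 2)) ^ q := by
      rw [show 2 * i + 3 = 2 * i + 1 + 2 from rfl, show 2 * i + 2 = 2 * i + 1 + 1 from rfl, f₁, f₂, f,
        hs₁eq, hs₂eq, hseq, div_neg, div_neg, div_neg, sub_neg_eq_add, sub_neg_eq_add, sub_neg_eq_add]
      exact alt_odd_step hp hq hpq (hL₁ _).le (hL₂ _).le (hL (2 * i + 2)) (hw₁ (2 * i + 1)) (hw₂ (2 * i + 1))
        (hw (2 * i + 1)) hg₁pos hg₂pos hev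
    have ht : 0 < ctK L M N (2 * i + 3) / ctK L M N (2 * i + 2) := by
      rw [show 2 * i + 3 = 2 * i + 1 + 2 from rfl, show 2 * i + 2 = 2 * i + 1 + 1 from rfl, f, hseq, div_neg,
        sub_neg_eq_add]
      refine add_pos_of_pos_of_nonneg ?_ (div_nonneg ?_ hgpos.le)
      · rw [hL]; exact mul_pos (Real.rpow_pos_of_pos (hL₁ _) p) (Real.rpow_pos_of_pos (hL₂ _) q)
      · rw [hw]; exact mul_nonneg (Real.rpow_nonneg (hw₁ _) p) (Real.rpow_nonneg (hw₂ _) q)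
    refine ⟨fun k hk => ?_, ?_⟩
    · rcases Nat.lt_or_ge k (2 * i + 1) with h | h
      · exact hK k (by omega)
      · rcases Nat.lt_or_ge k (2 * i + 2) with h' | h'
        · have hk' : k = 2 * i + 1 := by omega
          subst hk'
          rw [pow_succ, pow_mul, neg_one_sq, one_pow, one_mul]
          nlinarith [hs]
        · have hk' : k = 2 * i + 2 := by omega
          subst hk'
          rw [show 2 * i + 2 = 2 * (i + 1) by ring, pow_mul, neg_one_sq, one_pow, one_mul,
            show 2 * (i + 1) + 1 = 2 * i + 3 by ring, show 2 * (i + 1) = 2 * i + 2 by ring]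
          exact ht
    · rw [show 2 * (i + 1) + 1 = 2 * i + 3 by ring, show 2 * (i + 1) = 2 * i + 2 by ring]
      exact hodd'

/-- **Semidefinite top step.**  If at both endpoints the pivots alternate for `k ≤ 2i` and the next (even-indexed) pivot is
`≤ 0`, then the same holds for the interpolated continuants. [this file] -/
theorem ctK_alt_semidef_interp (hp : 0 < p) (hq : 0 < q) (hpq : p + q = 1)
    (hL₁ : ∀ k, 0 < L₁ k) (hL₂ : ∀ k, 0 < L₂ k) (hL : ∀ k, L k = L₁ k ^ p * L₂ k ^ q)
    (hw₁ : ∀ k, 0 ≤ -(M₁ k * N₁ (k + 1))) (hw₂ : ∀ k, 0 ≤ -(M₂ k * N₂ (k + 1)))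
    (hw : ∀ k, -(M k * N (k + 1)) = (-(M₁ k * N₁ (k + 1))) ^ p * (-(M₂ k * N₂ (k + 1))) ^ q) (i : ℕ)
    (hK₁ : ∀ k ≤ 2 * i, 0 < (-1 : ℝ) ^ k * (ctK L₁ M₁ N₁ (k + 1) / ctK L₁ M₁ N₁ k))
    (hK₂ : ∀ k ≤ 2 * i, 0 < (-1 : ℝ) ^ k * (ctK L₂ M₂ N₂ (k + 1) / ctK L₂ M₂ N₂ k))
    (hs₁ : ctK L₁ M₁ N₁ (2 * i + 2) / ctK L₁ M₁ N₁ (2 * i + 1) ≤ 0)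
    (hs₂ : ctK L₂ M₂ N₂ (2 * i + 2) / ctK L₂ M₂ N₂ (2 * i + 1) ≤ 0) :
    (∀ k ≤ 2 * i, 0 < (-1 : ℝ) ^ k * (ctK L M N (k + 1) / ctK L M N k)) ∧
      ctK L M N (2 * i + 2) / ctK L M N (2 * i + 1) ≤ 0 := by
  obtain ⟨hK, hodd⟩ := ctK_alt_interp hp hq hpq hL₁ hL₂ hL hw₁ hw₂ hw i hK₁ hK₂
  refine ⟨hK, ?_⟩
  have hr₁ : 0 < ctK L₁ M₁ N₁ (2 * i + 1) / ctK L₁ M₁ N₁ (2 * i) := by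
    have := hK₁ (2 * i) le_rfl; rwa [pow_mul, neg_one_sq, one_pow, one_mul] at this
  have hr₂ : 0 < ctK L₂ M₂ N₂ (2 * i + 1) / ctK L₂ M₂ N₂ (2 * i) := by
    have := hK₂ (2 * i) le_rfl; rwa [pow_mul, neg_one_sq, one_pow, one_mul] at this
  have hr : 0 < ctK L M N (2 * i + 1) / ctK L M N (2 * i) := by
    have := hK (2 * i) le_rfl; rwa [pow_mul, neg_one_sq, one_pow, one_mul] at this
  have e₁ := ctK_pivot_succ L₁ M₁ N₁ (2 * i) (ne_zero_of_sign_div (hK₁ (2 * i) le_rfl)).1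
  have e₂ := ctK_pivot_succ L₂ M₂ N₂ (2 * i) (ne_zero_of_sign_div (hK₂ (2 * i) le_rfl)).1
  have e := ctK_pivot_succ L M N (2 * i) (ne_zero_of_sign_div (hK (2 * i) le_rfl)).1
  have hg₁ : L₁ (2 * i + 1) ≤ -(M₁ (2 * i) * N₁ (2 * i + 1)) / (ctK L₁ M₁ N₁ (2 * i + 1) / ctK L₁ M₁ N₁ (2 * i)) := by
    rw [e₁] at hs₁; linarith
  have hg₂ : L₂ (2 * i + 1) ≤ -(M₂ (2 * i) * N₂ (2 * i + 1)) / (ctK L₂ M₂ N₂ (2 * i + 1) / ctK L₂ M₂ N₂ (2 * i)) := by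
    rw [e₂] at hs₂; linarith
  have hev := alt_even_step hp hq hpq (hL₁ _).le (hL₂ _).le (hL (2 * i + 1)) (hw₁ _) (hw₂ _) (hw (2 * i))
    hr₁ hr₂ hr hodd hg₁ hg₂
  have hlow : 0 ≤ (-(M₁ (2 * i) * N₁ (2 * i + 1)) / (ctK L₁ M₁ N₁ (2 * i + 1) / ctK L₁ M₁ N₁ (2 * i)) - L₁ (2 * i + 1)) ^ p *
      (-(M₂ (2 * i) * N₂ (2 * i + 1)) / (ctK L₂ M₂ N₂ (2 * i + 1) / ctK L₂ M₂ N₂ (2 * i)) - L₂ (2 * i + 1)) ^ q :=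
    mul_nonneg (Real.rpow_nonneg (sub_nonneg.mpr hg₁) p) (Real.rpow_nonneg (sub_nonneg.mpr hg₂) q)
  rw [e]
  linarith

/-- **Strict top step.**  If at both endpoints the pivots alternate for `k ≤ 2i+1`, then so do the interpolated ones.
[this file] -/
theorem ctK_alt_interp_succ (hp : 0 < p) (hq : 0 < q) (hpq : p + q = 1)
    (hL₁ : ∀ k, 0 < L₁ k) (hL₂ : ∀ k, 0 < L₂ k) (hL : ∀ k, L k = L₁ k ^ p * L₂ k ^ q)
    (hw₁ : ∀ k, 0 ≤ -(M₁ k * N₁ (k + 1))) (hw₂ : ∀ k, 0 ≤ -(M₂ k * N₂ (k + 1)))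
    (hw : ∀ k, -(M k * N (k + 1)) = (-(M₁ k * N₁ (k + 1))) ^ p * (-(M₂ k * N₂ (k + 1))) ^ q) (i : ℕ)
    (hK₁ : ∀ k ≤ 2 * i + 1, 0 < (-1 : ℝ) ^ k * (ctK L₁ M₁ N₁ (k + 1) / ctK L₁ M₁ N₁ k))
    (hK₂ : ∀ k ≤ 2 * i + 1, 0 < (-1 : ℝ) ^ k * (ctK L₂ M₂ N₂ (k + 1) / ctK L₂ M₂ N₂ k)) :
    ∀ k ≤ 2 * i + 1, 0 < (-1 : ℝ) ^ k * (ctK L M N (k + 1) / ctK L M N k) := by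
  obtain ⟨hK, hodd⟩ := ctK_alt_interp hp hq hpq hL₁ hL₂ hL hw₁ hw₂ hw i (fun k hk => hK₁ k (by omega))
    (fun k hk => hK₂ k (by omega))
  have hr₁ : 0 < ctK L₁ M₁ N₁ (2 * i + 1) / ctK L₁ M₁ N₁ (2 * i) := by
    have := hK₁ (2 * i) (by omega); rwa [pow_mul, neg_one_sq, one_pow, one_mul] at this
  have hr₂ : 0 < ctK L₂ M₂ N₂ (2 * i + 1) / ctK L₂ M₂ N₂ (2 * i) := by
    have := hK₂ (2 * i) (by omega); rwa [pow_mul, neg_one_sq, one_pow, one_mul] at this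
  have hr : 0 < ctK L M N (2 * i + 1) / ctK L M N (2 * i) := by
    have := hK (2 * i) le_rfl; rwa [pow_mul, neg_one_sq, one_pow, one_mul] at this
  have hs₁ : ctK L₁ M₁ N₁ (2 * i + 2) / ctK L₁ M₁ N₁ (2 * i + 1) < 0 := by
    have := hK₁ (2 * i + 1) le_rfl; rw [pow_succ, pow_mul, neg_one_sq, one_pow, one_mul] at this; linarith
  have hs₂ : ctK L₂ M₂ N₂ (2 * i + 2) / ctK L₂ M₂ N₂ (2 * i + 1) < 0 := by
    have := hK₂ (2 * i + 1) le_rfl; rw [pow_succ, pow_mul, neg_one_sq, one_pow, one_mul] at this; linarith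
  have e₁ := ctK_pivot_succ L₁ M₁ N₁ (2 * i) (ne_zero_of_sign_div (hK₁ (2 * i) (by omega))).1
  have e₂ := ctK_pivot_succ L₂ M₂ N₂ (2 * i) (ne_zero_of_sign_div (hK₂ (2 * i) (by omega))).1
  have e := ctK_pivot_succ L M N (2 * i) (ne_zero_of_sign_div (hK (2 * i) le_rfl)).1
  have hg₁ : 0 < -(M₁ (2 * i) * N₁ (2 * i + 1)) / (ctK L₁ M₁ N₁ (2 * i + 1) / ctK L₁ M₁ N₁ (2 * i)) - L₁ (2 * i + 1) := by
    rw [e₁] at hs₁; linarith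
  have hg₂ : 0 < -(M₂ (2 * i) * N₂ (2 * i + 1)) / (ctK L₂ M₂ N₂ (2 * i + 1) / ctK L₂ M₂ N₂ (2 * i)) - L₂ (2 * i + 1) := by
    rw [e₂] at hs₂; linarith
  have hev := alt_even_step hp hq hpq (hL₁ _).le (hL₂ _).le (hL (2 * i + 1)) (hw₁ _) (hw₂ _) (hw (2 * i))
    hr₁ hr₂ hr hodd (by linarith [hg₁]) (by linarith [hg₂])
  have hlow : 0 < (-(M₁ (2 * i) * N₁ (2 * i + 1)) / (ctK L₁ M₁ N₁ (2 * i + 1) / ctK L₁ M₁ N₁ (2 * i)) - L₁ (2 * i + 1)) ^ p *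
      (-(M₂ (2 * i) * N₂ (2 * i + 1)) / (ctK L₂ M₂ N₂ (2 * i + 1) / ctK L₂ M₂ N₂ (2 * i)) - L₂ (2 * i + 1)) ^ q :=
    mul_pos (Real.rpow_pos_of_pos hg₁ p) (Real.rpow_pos_of_pos hg₂ q)
  intro k hk
  rcases Nat.lt_or_ge k (2 * i + 1) with h | h
  · exact hK k (by omega)
  · have hk' : k = 2 * i + 1 := by omega
    subst hk'
    rw [pow_succ, pow_mul, neg_one_sq, one_pow, one_mul, show 2 * i + 1 + 1 = 2 * i + 2 from rfl, e]
    nlinarith [hev, hlow]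

/-- **Alternating interpolation, any prefix.**  If at both endpoints the pivots alternate for `k < K`, then so do the
interpolated ones. [this file] -/
theorem ctK_alt_pattern_interp (hp : 0 < p) (hq : 0 < q) (hpq : p + q = 1)
    (hL₁ : ∀ k, 0 < L₁ k) (hL₂ : ∀ k, 0 < L₂ k) (hL : ∀ k, L k = L₁ k ^ p * L₂ k ^ q)
    (hw₁ : ∀ k, 0 ≤ -(M₁ k * N₁ (k + 1))) (hw₂ : ∀ k, 0 ≤ -(M₂ k * N₂ (k + 1)))
    (hw : ∀ k, -(M k * N (k + 1)) = (-(M₁ k * N₁ (k + 1))) ^ p * (-(M₂ k * N₂ (k + 1))) ^ q) (K : ℕ)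
    (hK₁ : ∀ k < K, 0 < (-1 : ℝ) ^ k * (ctK L₁ M₁ N₁ (k + 1) / ctK L₁ M₁ N₁ k))
    (hK₂ : ∀ k < K, 0 < (-1 : ℝ) ^ k * (ctK L₂ M₂ N₂ (k + 1) / ctK L₂ M₂ N₂ k)) :
    ∀ k < K, 0 < (-1 : ℝ) ^ k * (ctK L M N (k + 1) / ctK L M N k) := by
  rcases Nat.even_or_odd K with ⟨j, hj⟩ | ⟨j, hj⟩
  · rcases j with _ | i
    · intro k hk; omega
    · have hKe : K = 2 * i + 2 := by omega
      intro k hk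
      exact ctK_alt_interp_succ hp hq hpq hL₁ hL₂ hL hw₁ hw₂ hw i (fun k hk => hK₁ k (by omega))
        (fun k hk => hK₂ k (by omega)) k (by omega)
  · have hKo : K = 2 * j + 1 := by omega
    intro k hk
    exact (ctK_alt_interp hp hq hpq hL₁ hL₂ hL hw₁ hw₂ hw j (fun k hk => hK₁ k (by omega))
      (fun k hk => hK₂ k (by omega))).1 k (by omega)

end Alternating

end Summit.ValiantsHypothesis.ValiantsHypothesis.Theorems.KPlusLogSqLaw.DefiniteInterpolation
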